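import Mathlib
import Summits.Ventures.HodgeRepro2.T5HodgeStar
import Summits.Ventures.HodgeRepro2.T5KahlerModel
import Summits.Ventures.HodgeRepro2.T5PrimitiveOneOne
import Summits.Ventures.HodgeRepro2.T5HermNormalisation

/-!
# Theorem 6.32, first clause, at `k = 2`: the types are `H₂`-orthogonal

Tier-5 support for sub-step N1 (Hodge-theoretic side, route/T5-N1-hodge-p6.md §H1 (V5) / §H3).
Voisin, Hodge Theory I, Theorem 6.32 [p0128 l. 35] has two clauses: «The subspaces
`H^{p,q}(X) ⊂ H^k(X, ℂ)` form an orthogonal direct sum for `H_k`», and the positivity of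
`(−1)^{k(k−1)/2} i^{p−q−k} H_k` on `H^{p,q}_{prim}`.  In the six-coefficient model of the
2-covectors at a point of a surface (`n = k = 2`, `T5HodgeStar`) the second clause is
kernel-checked at `(2,0)` (`T5HodgeStar.wedge_conjC_twoZero_self_pos`) and at `(1,1)`
(`T5PrimitiveOneOne.thm632_oneOne_pos`).  This file records the FIRST clause in the same
model: with `H₂(γ, δ) = i² Q(γ, δ̄) = −(γ ∧ δ̄)` (the Vol-coefficient, `ω^{n−k} = 1`),
the six cross-type products `γ ∧ δ̄` vanish (each is a form of type `(p + q', q + p')` with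
`(p, q) ≠ (p', q')`, hence of type `≠ (2,2)`), so `H₂` of two 2-covectors is the sum of the
three `H₂`'s of their type components (`H2_types`, `H2_decomposition`); the file also records
the missing third positivity, at `(0,2)`, in the printed form (`thm632_conjC_twoZero_pos`).

Everything is a finite computation with complex numbers in the model; Theorem 6.32 as a
statement about cohomology classes and harmonic representatives stays prose (memo §H3).
-/

namespace Summit.Ventures.HodgeRepro2.T5TypeOrthogonality

open Complex T5HodgeStar T5KahlerModel T5PrimitiveOneOne T5HermNormalisation

/-- The hermitian form `H₂(γ, δ) = i^k Q(γ, δ̄)` of Voisin p0128 l. 23 with `k = n = 2`,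
pointwise in the model: `Q(γ, δ) = ω^{n−k} ∧ γ ∧ δ = γ ∧ δ` is the Vol-coefficient `wedge`. -/
def H2 (γ δ : TwoCovector) : ℂ := I ^ 2 * wedge γ (conjC δ)

/-- `H₂(γ, δ) = −(γ ∧ δ̄)`. -/
theorem H2_eq_neg_wedge (γ δ : TwoCovector) : H2 γ δ = -wedge γ (conjC δ) := by
  simp [H2, I_sq]

/-- `wedge` is additive in the first variable. -/
theorem wedge_add_left (γ γ' δ : TwoCovector) : wedge (γ + γ') δ = wedge γ δ + wedge γ' δ := by
  simp [wedge]; ring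

/-- `wedge` is additive in the second variable. -/
theorem wedge_add_right (γ δ δ' : TwoCovector) : wedge γ (δ + δ') = wedge γ δ + wedge γ δ' := by
  simp [wedge]; ring

/-- `conjC` is additive. -/
theorem conjC_add (γ δ : TwoCovector) : conjC (γ + δ) = conjC γ + conjC δ := by
  ext i; simp [conjC]

/-- `conjC` is an involution. -/
theorem conjC_conjC (γ : TwoCovector) : conjC (conjC γ) = γ := by
  ext i; simp [conjC]

/-- The Vol-coefficient of `γ̄ ∧ δ̄` is the conjugate of that of `γ ∧ δ`. -/
theorem wedge_conjC_conjC (γ δ : TwoCovector) :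
    wedge (conjC γ) (conjC δ) = (starRingEnd ℂ) (wedge γ δ) := by
  simp [wedge, conjC, map_add, map_sub, map_mul]

/-! ### The six cross-type products vanish -/

/-- `Λ^{2,0} ∧ \overline{Λ^{1,1}} = Λ^{3,1} = 0`. -/
theorem wedge_twoZero_conjC_oneOne (a : ℂ) (c : Fin 2 → Fin 2 → ℂ) :
    wedge (twoZero a) (conjC (oneOne c)) = 0 := by
  rw [conjC_oneOne, wedge_comm, wedge_oneOne_twoZero]

/-- `Λ^{2,0} ∧ \overline{Λ^{0,2}} = Λ^{4,0} = 0`. -/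
theorem wedge_twoZero_conjC_conjC_twoZero (a b : ℂ) :
    wedge (twoZero a) (conjC (conjC (twoZero b))) = 0 := by
  rw [conjC_conjC, wedge_twoZero_twoZero]

/-- `Λ^{1,1} ∧ \overline{Λ^{2,0}} = Λ^{1,3} = 0`. -/
theorem wedge_oneOne_conjC_twoZero' (c : Fin 2 → Fin 2 → ℂ) (a : ℂ) :
    wedge (oneOne c) (conjC (twoZero a)) = 0 :=
  wedge_oneOne_conjC_twoZero c a

/-- `Λ^{1,1} ∧ \overline{Λ^{0,2}} = Λ^{3,1} = 0`. -/
theorem wedge_oneOne_conjC_conjC_twoZero (c : Fin 2 → Fin 2 → ℂ) (b : ℂ) :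
    wedge (oneOne c) (conjC (conjC (twoZero b))) = 0 := by
  rw [conjC_conjC, wedge_oneOne_twoZero]

/-- `Λ^{0,2} ∧ \overline{Λ^{2,0}} = Λ^{0,4} = 0`. -/
theorem wedge_conjC_twoZero_conjC_twoZero (b a : ℂ) :
    wedge (conjC (twoZero b)) (conjC (twoZero a)) = 0 := by
  rw [wedge_conjC_conjC, wedge_twoZero_twoZero, map_zero]

/-- `Λ^{0,2} ∧ \overline{Λ^{1,1}} = Λ^{1,3} = 0`. -/
theorem wedge_conjC_twoZero_conjC_oneOne (b : ℂ) (c : Fin 2 → Fin 2 → ℂ) :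
    wedge (conjC (twoZero b)) (conjC (oneOne c)) = 0 := by
  rw [wedge_conjC_conjC, wedge_comm, wedge_oneOne_twoZero, map_zero]

/-- `H₂` is additive in the first variable. -/
theorem H2_add_left (γ γ' δ : TwoCovector) : H2 (γ + γ') δ = H2 γ δ + H2 γ' δ := by
  simp only [H2, wedge_add_left]; ring

/-- `H₂` is additive in the second variable. -/
theorem H2_add_right (γ δ δ' : TwoCovector) : H2 γ (δ + δ') = H2 γ δ + H2 γ δ' := by
  simp only [H2, conjC_add, wedge_add_right]; ring

/-- **Theorem 6.32, first clause, at `k = 2`** (pointwise in the model): for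
`γ = γ^{2,0} + γ^{1,1} + γ^{0,2}` and `δ = δ^{2,0} + δ^{1,1} + δ^{0,2}`,
`H₂(γ, δ) = H₂(γ^{2,0}, δ^{2,0}) + H₂(γ^{1,1}, δ^{1,1}) + H₂(γ^{0,2}, δ^{0,2})` —
the three types are mutually `H₂`-orthogonal. -/
theorem H2_types (a a' b b' : ℂ) (c c' : Fin 2 → Fin 2 → ℂ) :
    H2 (twoZero a + oneOne c + conjC (twoZero b)) (twoZero a' + oneOne c' + conjC (twoZero b')) =
      H2 (twoZero a) (twoZero a') + H2 (oneOne c) (oneOne c') +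
        H2 (conjC (twoZero b)) (conjC (twoZero b')) := by
  simp only [H2_add_left, H2_add_right]
  simp only [H2, wedge_twoZero_conjC_oneOne,
    wedge_twoZero_conjC_conjC_twoZero, wedge_oneOne_conjC_twoZero',
    wedge_oneOne_conjC_conjC_twoZero, wedge_conjC_twoZero_conjC_twoZero,
    wedge_conjC_twoZero_conjC_oneOne, mul_zero, add_zero, zero_add]

/-- The first clause for arbitrary 2-covectors, through the type decomposition of
`T5HermNormalisation.exists_type_decomposition`: every `γ`, `δ` decompose into types and
`H₂(γ, δ)` is the sum of the three type-wise values. -/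
theorem H2_decomposition (γ δ : TwoCovector) :
    ∃ a c b a' c' b', γ = twoZero a + oneOne c + conjC (twoZero b) ∧
      δ = twoZero a' + oneOne c' + conjC (twoZero b') ∧
      H2 γ δ = H2 (twoZero a) (twoZero a') + H2 (oneOne c) (oneOne c') +
        H2 (conjC (twoZero b)) (conjC (twoZero b')) := by
  obtain ⟨a, c, b, hγ⟩ := exists_type_decomposition γ
  obtain ⟨a', c', b', hδ⟩ := exists_type_decomposition δ
  exact ⟨a, c, b, a', c', b', hγ, hδ, by rw [hγ, hδ, H2_types]⟩

/-! ### The values on each type, and the third positivity -/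

/-- `H₂(α, β) = −4 a b̄` on the `(2,0)`-covectors `α = a dz₁∧dz₂`, `β = b dz₁∧dz₂`
(`T5HodgeStar.wedge_conjC_twoZero_eq`). -/
theorem H2_twoZero (a b : ℂ) : H2 (twoZero a) (twoZero b) = -(4 * a * (starRingEnd ℂ) b) := by
  rw [H2_eq_neg_wedge, wedge_conjC_twoZero_eq]

/-- `H₂(ᾱ, β̄) = −4 ā b` on the `(0,2)`-covectors. -/
theorem H2_conjC_twoZero (a b : ℂ) :
    H2 (conjC (twoZero a)) (conjC (twoZero b)) = -(4 * (starRingEnd ℂ) a * b) := by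
  rw [H2_eq_neg_wedge, conjC_conjC, wedge_comm, wedge_conjC_twoZero_eq]; ring

/-- `−H₂(ᾱ, ᾱ) = 4|a|² > 0` for a non-zero `(0,2)`-covector `ᾱ`. -/
theorem neg_H2_conjC_twoZero_self_pos (a : ℂ) (ha : a ≠ 0) :
    0 < (-H2 (conjC (twoZero a)) (conjC (twoZero a))).re := by
  rw [H2_conjC_twoZero, neg_neg, mul_comm (4 * (starRingEnd ℂ) a) a, ← mul_assoc, mul_comm a 4,
    mul_assoc, Complex.mul_conj]
  have := Complex.normSq_pos.mpr ha
  simpa using this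

/-- `i^{−4} = 1`. -/
theorem I_zpow_neg_four : I ^ ((0 : ℤ) - 2 - 2) = 1 := by
  have h : ((0 : ℤ) - 2 - 2) = -4 := by norm_num
  rw [h, zpow_neg, show (4 : ℤ) = (4 : ℕ) by norm_num, zpow_natCast, I_pow_four]; norm_num

/-- The printed form of Theorem 6.32 at `(p, q, k) = (0, 2, 2)`:
`(−1)^{k(k−1)/2} i^{p−q−k} H₂ = (−1) · i^{−4} · H₂ = −H₂` is positive definite on `Λ^{0,2}`
(the companion of `T5HodgeStar.wedge_conjC_twoZero_self_pos` at `(2,0)` and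
`T5PrimitiveOneOne.thm632_oneOne_pos` at `(1,1)`). -/
theorem thm632_conjC_twoZero_pos (a : ℂ) (ha : a ≠ 0) :
    0 < ((-1) ^ (2 * (2 - 1) / 2) * I ^ ((0 : ℤ) - 2 - 2) *
      (I ^ 2 * wedge (conjC (twoZero a)) (conjC (conjC (twoZero a))))).re := by
  have h := neg_H2_conjC_twoZero_self_pos a ha
  simp only [H2] at h
  rw [I_zpow_neg_four]
  simpa using h

/-- The printed form of Theorem 6.32 at `(p, q, k) = (2, 0, 2)`, for the record next to the
other two: `(−1)^{1} i^{0} H₂ = −H₂ = 4|a|² > 0` on `Λ^{2,0} ∖ 0`. -/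
theorem thm632_twoZero_pos (a : ℂ) (ha : a ≠ 0) :
    0 < ((-1) ^ (2 * (2 - 1) / 2) * I ^ ((2 : ℤ) - 0 - 2) *
      (I ^ 2 * wedge (twoZero a) (conjC (twoZero a)))).re := by
  have h : wedge (twoZero a) (conjC (twoZero a)) = 4 * a * (starRingEnd ℂ) a :=
    wedge_conjC_twoZero_eq a a
  rw [h, mul_assoc 4 a, Complex.mul_conj]
  have := Complex.normSq_pos.mpr ha
  simp [I_sq]
  simpa using this

end Summit.Ventures.HodgeRepro2.T5TypeOrthogonality
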